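import Mathlib
import Literature.Computability.AlgebraicComplexity.GroupTheoreticMatMulThmBProofs
import Summits.MatrixMultiplication.MatrixMultiplication.Theses.CommutativeSchemes
import Summits.MatrixMultiplication.MatrixMultiplication.Theorems.CommutativeSchemesSTPPTransferSymPower

/-!
# MatrixMultiplication / CommutativeSchemes — `STPPTransfer` (stmt-MatrixMultiplication-9469)

Route `CommutativeSchemes`, support item `STPPTransfer`: the abelian STPP packing thesis of
route `GroupTheoreticSTPP` (`CThesis`, inlined: for every `ε > 0` some finite abelian group `H`
carries an STPP family `(A i, B i, C i)_{i < N}` with `|H| < Σᵢ (|A i||B i||C i|)^{(2+ε)/3}`)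
implies `CommutativeRealization` (Cohn–Umans 2013, Conjecture 21 in ε-form: commutative
association schemes with at most `n^{2+ε}` classes realising `⟨n, n, n⟩`). This is
Cohn–Umans 2013 §5 (Thm. 17, Cor. 18, Thm. 19 and the remark after Conj. 21: "If Conjecture 3.4 or
4.7 from [CKSU] hold, then Conjecture 21 holds via Theorem 19"), made effective.

Proof. Fix the target `ε` and apply the hypothesis with `ε₀ = ε/2`, `θ = (2+ε₀)/3`.
1. *Types* (proof of CU13 Thm. 19 / BCCGNSU17 Lemma 3.5): with `sᵢ = |A i||B i||C i|` and
   `S = Σ sᵢ^θ > |H|`, expand `S^N = Σ_τ T_τ m_τ^θ` over the types `τ` of words `u ∈ [N₀]^N`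
   (`T_τ` words of type `τ`, `m_τ = ∏ sᵢ^{τᵢ}`); since there are at most `(N+1)^{N₀}` types and
   `S/|H| > 1`, some `N, τ` has `T_τ m_τ^θ > |H|^N` (`exists_wordType_fiber_gt`, by the tree's
   growth lemma `le_of_pow_le_poly_mul_pow`).
2. *Uniform cube family* (BCCGNSU17 Lemma 3.5): the product of the three rotations of the
   `N`-th power family, restricted to words of type `τ`, is an STPP family in `G₁ = (H^N)^3` with
   `T_τ^3` triples, all of size `(m_τ, m_τ, m_τ)` (`exists_uniform_family_of_wordType`); so
   `|G₁| = |H|^{3N} < T_τ^3 m_τ^{2+ε₀}`, and the packing bound forces `m_τ ≥ 2`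
   (`two_le_of_uniform`).
3. *Direct power* (CU13 Cor. 18): the `t`-th power is uniform of size `L = m_τ^t` with
   `K = T_τ^{3t}` triples in `G = G₁^t`, still `|G| < K L^{2+ε₀}`; choose `t` with
   `L^{ε-ε₀} ≥ 6`.
4. *Symmetric power* (CU13 Thm. 17, file `CommutativeSchemesSTPPTransferSymPower.lean`):
   `Sym^K 𝒞_G` is a commutative association scheme on `K → G` with `C(|G|+K-1, K)` classes
   realising `⟨L^K, L^K, L^K⟩`.
5. *Counting* (CU13 Cor. 18: `C(r+k-1,k) ≤ (e(r+k-1)/k)^k`): `C(|G|+K-1, K) ≤ (|G|+K)^K/K!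
   ≤ (|G|/K + 1)^K e^K < (2e L^{2+ε₀})^K ≤ (6 L^{2+ε₀})^K ≤ (L^{ε-ε₀} L^{2+ε₀})^K = (L^K)^{2+ε}`
   (`choose_le_rpow_pow`).

References: H. Cohn, C. Umans, *Fast matrix multiplication using coherent configurations*,
SODA 2013, arXiv:1207.6528, §5; J. Blasiak, T. Church, H. Cohn, J. A. Grochow, E. Naslund,
W. F. Sawin, C. Umans, *On cap sets and the group-theoretic approach to matrix multiplication*,
Discrete Analysis 2017:3, Lemma 3.5 (the type/rotation bookkeeping, as formalised in
`Literature/Computability/AlgebraicComplexity/GroupTheoreticMatMulThmBProofs.lean`).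
-/

noncomputable section

-- the tree's namespace `Summit.MatrixMultiplication.MatrixMultiplication.…` repeats a component by design
set_option linter.dupNamespace false

namespace Summit.MatrixMultiplication.MatrixMultiplication.Theorems

open Finset Function Literature.Combinatorics.AssociationSchemes Literature.Combinatorics.Additive
open Literature.Computability.AlgebraicComplexity.Combinatorics

/-! ### Step 1: types -/

/-- **Pigeonhole over types** (Cohn–Umans 2013, proof of Thm. 19; BCCGNSU 2017, proof of
Lemma 3.5): if `h < Σᵢ mᵢ^θ` (`h > 0`), then for some `N ≥ 1` and some type
`τ : ι₀ → {0,…,N}` the words `u ∈ ι₀^N` of type `τ` satisfy `T_τ · (∏ᵢ mᵢ^{τᵢ})^θ > h^N`: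
otherwise `(Σᵢ mᵢ^θ)^N = Σ_τ T_τ (∏ᵢ mᵢ^{τᵢ})^θ ≤ (N+1)^{|ι₀|} h^N` for all `N`, forcing
`Σᵢ mᵢ^θ ≤ h`. [cite: CohnUmans2013, Thm. 19] -/
theorem exists_wordType_fiber_gt {ι₀ : Type} [Fintype ι₀] [DecidableEq ι₀] (m : ι₀ → ℕ)
    {θ h : ℝ} (hh : 0 < h) (hlt : h < ∑ i, ((m i : ℕ) : ℝ) ^ θ) :
    ∃ N : ℕ, 1 ≤ N ∧ ∃ τ : ι₀ → Fin (N + 1),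
      h ^ N < ((univ.filter fun u : Fin N → ι₀ => wordType u = τ).card : ℝ) *
        (((∏ i, m i ^ (τ i : ℕ) : ℕ) : ℝ)) ^ θ := by
  by_contra hcon
  push Not at hcon
  set F : ℝ := ∑ i, ((m i : ℕ) : ℝ) ^ θ with hF
  have hclaim : ∀ N : ℕ, 1 ≤ N → F ^ N ≤ 1 * ((N : ℝ) + 1) ^ Fintype.card ι₀ * h ^ N := by
    intro N hN
    have hFN : F ^ N =
        ∑ u : Fin N → ι₀, (((∏ i, m i ^ (wordType u i : ℕ) : ℕ) : ℝ)) ^ θ := by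
      have h1 : F ^ N = ∏ _l : Fin N, F := by
        rw [Finset.prod_const, card_univ, Fintype.card_fin]
      rw [h1, hF, Fintype.prod_sum (fun (_ : Fin N) (i : ι₀) => ((m i : ℕ) : ℝ) ^ θ)]
      refine Finset.sum_congr rfl fun u _ => ?_
      rw [Real.finsetProd_rpow _ _ (fun l _ => by positivity), ← prod_eq_prod_pow_wordType m u]
      push_cast
      rfl
    rw [hFN, ← Finset.sum_fiberwise_of_maps_to (g := wordType) (t := univ)
      (fun u _ => mem_univ _)]
    have hτ : ∀ τ : ι₀ → Fin (N + 1),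
        ∑ u ∈ univ.filter (fun u => wordType u = τ),
          (((∏ i, m i ^ (wordType u i : ℕ) : ℕ) : ℝ)) ^ θ ≤ h ^ N := by
      intro τ
      rw [Finset.sum_congr rfl fun u hu => (show (((∏ i, m i ^ (wordType u i : ℕ) : ℕ) : ℝ)) ^
        θ = (((∏ i, m i ^ (τ i : ℕ) : ℕ) : ℝ)) ^ θ by rw [(mem_filter.1 hu).2]),
        Finset.sum_const, nsmul_eq_mul]
      exact hcon N hN τ
    calc ∑ τ : ι₀ → Fin (N + 1), ∑ u ∈ univ.filter (fun u => wordType u = τ),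
          (((∏ i, m i ^ (wordType u i : ℕ) : ℕ) : ℝ)) ^ θ
        ≤ ∑ _τ : ι₀ → Fin (N + 1), h ^ N := Finset.sum_le_sum fun τ _ => hτ τ
      _ = 1 * ((N : ℝ) + 1) ^ Fintype.card ι₀ * h ^ N := by
          rw [Finset.sum_const, card_univ, nsmul_eq_mul, Fintype.card_fun, Fintype.card_fin]
          push_cast
          ring
  have hle := le_of_pow_le_poly_mul_pow hh hclaim
  linarith

/-! ### Step 2: the uniform cube family of a type -/

/-- **Uniform cube sub-family** (BCCGNSU 2017, proof of Lemma 3.5; CU13 proof of Thm. 19, "the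
key is that now these are all the same size"): for an STPP family `(A i, B i, C i)_{i ∈ ι₀}` in
`H`, `N ≥ 0` and a type `τ`, the product of the three rotations of its `N`-th power, restricted
to triples of words of type `τ`, is an STPP family in `(H^N)^3` with `T_τ^3` triples whose sets
all have size `m_τ = ∏ᵢ (|A i||B i||C i|)^{τᵢ}`.
[cite: BlasiakChurchCohnGrochowNaslundSawinUmans2017, Lemma 3.5 (proof)] -/
theorem exists_uniform_family_of_wordType {H : Type} [AddCommGroup H] {ι₀ : Type} [Fintype ι₀]
    [DecidableEq ι₀] {A B C : ι₀ → Finset H} (hS : AddSimultaneousTPP A B C) (N : ℕ)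
    (τ : ι₀ → Fin (N + 1)) :
    ∃ (κ : Type) (_ : Fintype κ)
      (A' B' C' : κ → Finset ((Fin N → H) × (Fin N → H) × (Fin N → H))),
      AddSimultaneousTPP A' B' C' ∧
        Fintype.card κ = (univ.filter fun u : Fin N → ι₀ => wordType u = τ).card ^ 3 ∧
        (∀ k, (A' k).card = ∏ i, ((A i).card * (B i).card * (C i).card) ^ (τ i : ℕ)) ∧
        (∀ k, (B' k).card = ∏ i, ((A i).card * (B i).card * (C i).card) ^ (τ i : ℕ)) ∧
        (∀ k, (C' k).card = ∏ i, ((A i).card * (B i).card * (C i).card) ^ (τ i : ℕ)) := by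
  classical
  set Tf : Finset (Fin N → ι₀) := univ.filter fun u => wordType u = τ with hTf
  have hTfmem : ∀ u : Tf, wordType u.1 = τ := fun u => (mem_filter.1 u.2).2
  set piA : (Fin N → ι₀) → Finset (Fin N → H) := fun u => Fintype.piFinset fun l => A (u l)
    with hpiA
  set piB : (Fin N → ι₀) → Finset (Fin N → H) := fun u => Fintype.piFinset fun l => B (u l)
    with hpiB
  set piC : (Fin N → ι₀) → Finset (Fin N → H) := fun u => Fintype.piFinset fun l => C (u l)
    with hpiC
  have hSpi : AddSimultaneousTPP (G := Fin N → H) piA piB piC := hS.pi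
  have hbig := hSpi.prod (hSpi.rotate.prod hSpi.rotate.rotate)
  set emb : Tf × Tf × Tf → (Fin N → ι₀) × (Fin N → ι₀) × (Fin N → ι₀) :=
    fun x => (x.1.1, x.2.1.1, x.2.2.1) with hemb
  have hinj : Function.Injective emb := by
    rintro ⟨u, v, w⟩ ⟨u', v', w'⟩ h
    simp only [hemb, Prod.mk.injEq] at h
    exact Prod.ext (Subtype.ext h.1) (Prod.ext (Subtype.ext h.2.1) (Subtype.ext h.2.2))
  have hSτ := hbig.comp hinj
  have hsA : ∀ u : Tf, (piA u.1).card = ∏ i, (A i).card ^ (τ i : ℕ) := by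
    intro u; rw [hpiA]; simp only
    rw [Fintype.card_piFinset, prod_eq_prod_pow_wordType (fun i => (A i).card) u.1, hTfmem u]
  have hsB : ∀ u : Tf, (piB u.1).card = ∏ i, (B i).card ^ (τ i : ℕ) := by
    intro u; rw [hpiB]; simp only
    rw [Fintype.card_piFinset, prod_eq_prod_pow_wordType (fun i => (B i).card) u.1, hTfmem u]
  have hsC : ∀ u : Tf, (piC u.1).card = ∏ i, (C i).card ^ (τ i : ℕ) := by
    intro u; rw [hpiC]; simp only
    rw [Fintype.card_piFinset, prod_eq_prod_pow_wordType (fun i => (C i).card) u.1, hTfmem u]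
  have hmτ : (∏ i, (A i).card ^ (τ i : ℕ)) * (∏ i, (B i).card ^ (τ i : ℕ)) *
      (∏ i, (C i).card ^ (τ i : ℕ)) = ∏ i, ((A i).card * (B i).card * (C i).card) ^ (τ i : ℕ) := by
    rw [← Finset.prod_mul_distrib, ← Finset.prod_mul_distrib]
    refine Finset.prod_congr rfl fun i _ => ?_
    rw [mul_pow, mul_pow]
  refine ⟨Tf × Tf × Tf, inferInstance, _, _, _, hSτ, ?_, fun x => ?_, fun x => ?_, fun x => ?_⟩
  · rw [Fintype.card_prod, Fintype.card_prod, Fintype.card_coe]; ring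
  · show (piA x.1.1 ×ˢ (piB x.2.1.1 ×ˢ piC x.2.2.1)).card = _
    rw [Finset.card_product, Finset.card_product, hsA, hsB, hsC, ← hmτ, mul_assoc]
  · show (piB x.1.1 ×ˢ (piC x.2.1.1 ×ˢ piA x.2.2.1)).card = _
    rw [Finset.card_product, Finset.card_product, hsA, hsB, hsC, ← hmτ]; ring
  · show (piC x.1.1 ×ˢ (piA x.2.1.1 ×ˢ piB x.2.2.1)).card = _
    rw [Finset.card_product, Finset.card_product, hsA, hsB, hsC, ← hmτ]; ring

/-- In a uniform STPP family (`|A k| = |B k| = |C k| = L`) with `|G| < |κ| · L^{2+ε₀}`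
(`ε₀ > 0`) one has `L ≥ 2`: `L = 0` is absurd and `L = 1` contradicts the packing bound
`Σₖ |A k||B k| ≤ |G|` (`AddSimultaneousTPP.sum_card_mul_card_le`).
[cite: BlasiakChurchCohnGrochowNaslundSawinUmans2017, §2] -/
theorem two_le_of_uniform {G : Type} [AddCommGroup G] [Fintype G] {κ : Type} [Fintype κ]
    {A B C : κ → Finset G} (hS : AddSimultaneousTPP A B C) {L : ℕ}
    (hA : ∀ k, (A k).card = L) (hB : ∀ k, (B k).card = L) (hC : ∀ k, (C k).card = L)
    {ε₀ : ℝ} (hε₀ : 0 < ε₀)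
    (hlt : (Fintype.card G : ℝ) < Fintype.card κ * (L : ℝ) ^ (2 + ε₀)) : 2 ≤ L := by
  classical
  by_contra hL
  push Not at hL
  interval_cases L
  · rw [Nat.cast_zero, Real.zero_rpow (by linarith), mul_zero] at hlt
    exact (Nat.cast_nonneg _).not_gt hlt
  · have hpack := hS.sum_card_mul_card_le fun k => Finset.card_pos.1 (by rw [hC k]; exact one_pos)
    simp only [hA, hB, mul_one, Finset.sum_const, card_univ, smul_eq_mul] at hpack
    rw [Nat.cast_one, Real.one_rpow, mul_one] at hlt
    exact (Nat.cast_le.2 hpack).not_gt hlt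

/-! ### Step 5: counting -/

/-- **Counting** (Cohn–Umans 2013, proof of Cor. 18: `C(r+k-1, k) ≤ (e(r+k-1)/k)^k ≤ (2er/k)^k`):
if `h < K · L^{2+ε₀}` and `L^{ε-ε₀} ≥ 6 > 2e`, then
`C(h+K-1, K) ≤ (h+K)^K/K! ≤ (h/K+1)^K e^K ≤ (2 L^{2+ε₀})^K 3^K ≤ (L^{ε-ε₀} L^{2+ε₀})^K = (L^K)^{2+ε}`.
[cite: CohnUmans2013, Cor. 18] -/
theorem choose_le_rpow_pow {h K L : ℕ} {ε₀ ε : ℝ} (hK : 1 ≤ K) (hL : 1 ≤ L) (hε₀ : 0 ≤ ε₀)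
    (hlt : (h : ℝ) < K * (L : ℝ) ^ (2 + ε₀)) (h6 : 6 ≤ (L : ℝ) ^ (ε - ε₀)) :
    (((h + K - 1).choose K : ℕ) : ℝ) ≤ ((L ^ K : ℕ) : ℝ) ^ (2 + ε) := by
  have hKpos : (0 : ℝ) < K := by exact_mod_cast hK
  have hLpos : (0 : ℝ) < L := by exact_mod_cast hL
  set M : ℝ := (L : ℝ) ^ (2 + ε₀) with hM
  have hM1 : 1 ≤ M := Real.one_le_rpow (by exact_mod_cast hL) (by linarith)
  -- `C(h+K-1, K) ≤ (h+K)^K / K!`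
  have h1 : (((h + K - 1).choose K : ℕ) : ℝ) ≤ ((h : ℝ) + K) ^ K / (K.factorial : ℝ) := by
    have h0 := Nat.choose_le_pow_div (α := ℝ) K (h + K - 1)
    refine h0.trans ?_
    have hsub : ((h + K - 1 : ℕ) : ℝ) ≤ (h : ℝ) + K := by exact_mod_cast Nat.sub_le _ _
    gcongr
  -- `K^K / K! ≤ e^K ≤ 3^K`
  have h2 : (K : ℝ) ^ K / (K.factorial : ℝ) ≤ 3 ^ K := by
    refine (Real.pow_div_factorial_le_exp _ hKpos.le K).trans ?_
    rw [← Real.exp_one_pow]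
    exact pow_le_pow_left₀ (Real.exp_pos 1).le
      (le_of_lt (lt_trans Real.exp_one_lt_d9 (by norm_num))) K
  -- `(h+K)/K ≤ 2 M`
  have h3 : ((h : ℝ) + K) / K ≤ 2 * M := by
    rw [add_div, div_self hKpos.ne']
    have : (h : ℝ) / K < M := by
      rw [div_lt_iff₀ hKpos, mul_comm]
      exact hlt
    linarith
  have h4 : ((h : ℝ) + K) ^ K / (K.factorial : ℝ) =
      (((h : ℝ) + K) / K) ^ K * ((K : ℝ) ^ K / K.factorial) := by
    rw [div_pow]
    field_simp
  calc (((h + K - 1).choose K : ℕ) : ℝ) ≤ ((h : ℝ) + K) ^ K / (K.factorial : ℝ) := h1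
    _ = (((h : ℝ) + K) / K) ^ K * ((K : ℝ) ^ K / K.factorial) := h4
    _ ≤ (2 * M) ^ K * 3 ^ K := by gcongr
    _ = (6 * M) ^ K := by rw [← mul_pow]; ring
    _ ≤ ((L : ℝ) ^ (ε - ε₀) * M) ^ K := by gcongr
    _ = ((L : ℝ) ^ (2 + ε)) ^ K := by
        rw [hM, ← Real.rpow_add hLpos]
        ring_nf
    _ = ((L ^ K : ℕ) : ℝ) ^ (2 + ε) := by
        rw [Nat.cast_pow, ← Real.rpow_natCast_mul hLpos.le, ← Real.rpow_mul_natCast hLpos.le,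
          mul_comm]

/-! ### Step 4: the symmetric power, packaged in the route's vocabulary -/

/-- The symmetric-power scheme of a uniform STPP family, in the inlined vocabulary of
`CommutativeRealization`: given the numerical side conditions `2 ≤ L^{|κ|}` and
`#Sym^{|κ|} G ≤ (L^{|κ|})^{2+ε}`, the scheme of `exists_symPower_scheme` witnesses the body of
CU13 Conj. 21 at `ε` with `n = L^{|κ|}`. [cite: CohnUmans2013, Thm. 17] -/
theorem commutativeRealization_body_of_uniform {G : Type} [AddCommGroup G] [Fintype G]
    [DecidableEq G] {κ : Type} [Fintype κ] [DecidableEq κ] {A B C : κ → Finset G}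
    (hS : AddSimultaneousTPP A B C) {L : ℕ} (hA : ∀ k, (A k).card = L)
    (hB : ∀ k, (B k).card = L) (hC : ∀ k, (C k).card = L) {ε : ℝ}
    (hn : 2 ≤ L ^ Fintype.card κ)
    (hr : ((Fintype.card (Sym G (Fintype.card κ)) : ℕ) : ℝ) ≤
      ((L ^ Fintype.card κ : ℕ) : ℝ) ^ (2 + ε)) :
    ∃ n : ℕ, 2 ≤ n ∧ ∃ (X : Type) (_ : Fintype X) (r : ℕ) (cls : X → X → Fin r),
      (r : ℝ) ≤ (n : ℝ) ^ (2 + ε) ∧ (∀ x y z : X, cls x y = cls z z ↔ x = y) ∧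
      (∃ τ : Fin r → Fin r, ∀ x y : X, cls y x = τ (cls x y)) ∧
      (∃ p : Fin r → Fin r → Fin r → ℕ, (∀ (a b : Fin r) (x y : X),
        (Finset.univ.filter (fun z : X => cls x z = a ∧ cls z y = b)).card = p a b (cls x y)) ∧
          ∀ a b c : Fin r, p a b c = p b a c) ∧
      ∃ α β γ : Fin n × Fin n → Fin r, Function.Injective α ∧ Function.Injective β ∧
        Function.Injective γ ∧ ∀ a a' b b' c c' : Fin n,
          ((∃ x y z : X, cls x y = α (a, b') ∧ cls y z = β (b, c') ∧ cls z x = γ (c, a')) ↔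
            (a = a' ∧ b = b' ∧ c = c')) := by
  obtain ⟨S, hcomm, hreal⟩ := exists_symPower_scheme hS hA hB hC
  refine ⟨L ^ Fintype.card κ, hn, κ → G, inferInstance, Fintype.card (Sym G (Fintype.card κ)),
    S.cls, ?_, S.cls_eq_cls_self_iff, S.exists_transpose, S.isCommutative_iff.1 hcomm, hreal⟩
  exact_mod_cast hr

/-! ### Assembly -/

/-- Sizes of boxes: the `t`-th power of a uniform family of size `L` is uniform of size `L^t`.
[folklore] -/
theorem card_piFinset_of_card_eq {G : Type} {κ : Type} {D : κ → Finset G} {L : ℕ}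
    (hD : ∀ k, (D k).card = L) (t : ℕ) (I : Fin t → κ) :
    (Fintype.piFinset fun l => D (I l)).card = L ^ t := by
  classical
  rw [Fintype.card_piFinset]
  simp only [hD, prod_const, card_univ, Fintype.card_fin]

/-- **`STPPTransfer`** (route `CommutativeSchemes`, stmt-MatrixMultiplication-9469): the abelian
STPP packing thesis implies CU13 Conjecture 21 in ε-form — Cohn–Umans 2013, Thm. 17 + Cor. 18 +
Thm. 19 made effective (types → uniform cube family → direct power → symmetric power → counting;
see the module docstring). [cite: CohnUmans2013, Thm. 19] -/
theorem stppTransfer_proof : Theses.CommutativeSchemes.STPPTransfer := by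
  intro hCT ε hε
  classical
  -- the hypothesis at `ε₀ = ε / 2`
  obtain ⟨H, _, _, N₀, A, B, C, hS0, hlt0⟩ := hCT (ε / 2) (by positivity)
  have hS : AddSimultaneousTPP A B C := (addSimultaneousTPP_iff_forall A B C).2 hS0
  set m : Fin N₀ → ℕ := fun i => (A i).card * (B i).card * (C i).card with hm
  have hHpos : (0 : ℝ) < Fintype.card H := Nat.cast_pos.2 Fintype.card_pos
  -- Step 1: a type with a large fibre
  obtain ⟨N, hN, τ, hτ⟩ := exists_wordType_fiber_gt m hHpos hlt0
  -- Step 2: the uniform cube family in `G₁ = (H^N)^3`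
  obtain ⟨κ, _, A', B', C', hS', hκ, hA', hB', hC'⟩ := exists_uniform_family_of_wordType hS N τ
  set T : ℕ := (univ.filter fun u : Fin N → Fin N₀ => wordType u = τ).card with hT
  set L : ℕ := ∏ i, m i ^ (τ i : ℕ) with hL
  have hG₁ : Fintype.card ((Fin N → H) × (Fin N → H) × (Fin N → H)) =
      Fintype.card H ^ (3 * N) := by
    rw [Fintype.card_prod, Fintype.card_prod, Fintype.card_fun, Fintype.card_fin]; ring
  have hkey : (Fintype.card ((Fin N → H) × (Fin N → H) × (Fin N → H)) : ℝ) <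
      Fintype.card κ * (L : ℝ) ^ (2 + ε / 2) := by
    rw [hG₁, hκ]
    push_cast
    have h3 : ((T : ℝ) * (L : ℝ) ^ ((2 + ε / 2) / 3)) ^ 3 = (T : ℝ) ^ 3 * (L : ℝ) ^ (2 + ε / 2) := by
      rw [mul_pow, ← Real.rpow_natCast ((L : ℝ) ^ ((2 + ε / 2) / 3)) 3,
        ← Real.rpow_mul (Nat.cast_nonneg _)]
      norm_num
    rw [pow_mul', ← h3]
    exact pow_lt_pow_left₀ hτ (by positivity) three_ne_zero
  -- `L ≥ 2`
  have hL2 : 2 ≤ L := two_le_of_uniform hS' hA' hB' hC' (by positivity) hkey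
  -- Step 3: the direct power `t`, with `(L^t)^{ε/2} ≥ 6`
  obtain ⟨t, ht1, ht6⟩ : ∃ t : ℕ, 1 ≤ t ∧ (6 : ℝ) ≤ ((L ^ t : ℕ) : ℝ) ^ (ε - ε / 2) := by
    refine ⟨⌈6 / ε⌉₊, Nat.one_le_iff_ne_zero.2 (Nat.ceil_pos.2 (by positivity)).ne', ?_⟩
    have hε2 : ε - ε / 2 = ε / 2 := by ring
    rw [hε2, Nat.cast_pow]
    have h2L : (2 : ℝ) ≤ L := by exact_mod_cast hL2
    have ht3 : (3 : ℝ) ≤ (⌈6 / ε⌉₊ : ℝ) * (ε / 2) := by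
      have hc := Nat.le_ceil (6 / ε)
      calc (3 : ℝ) = 6 / ε * (ε / 2) := by field_simp; ring
        _ ≤ (⌈6 / ε⌉₊ : ℝ) * (ε / 2) := by gcongr
    calc (6 : ℝ) ≤ (2 : ℝ) ^ (3 : ℝ) := by norm_num
      _ ≤ (2 : ℝ) ^ ((⌈6 / ε⌉₊ : ℝ) * (ε / 2)) :=
          Real.rpow_le_rpow_of_exponent_le (by norm_num) ht3
      _ = ((2 : ℝ) ^ (⌈6 / ε⌉₊)) ^ (ε / 2) := Real.rpow_natCast_mul (by norm_num) _ _
      _ ≤ ((L : ℝ) ^ (⌈6 / ε⌉₊)) ^ (ε / 2) := by gcongr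
  have hSt := hS'.pi (κ := Fin t)
  have hAt := card_piFinset_of_card_eq hA' t
  have hBt := card_piFinset_of_card_eq hB' t
  have hCt := card_piFinset_of_card_eq hC' t
  -- the numbers of the final family in `G = G₁^t` indexed by `κ^t`
  have hKt : Fintype.card (Fin t → κ) = Fintype.card κ ^ t := by
    rw [Fintype.card_fun, Fintype.card_fin]
  have hGt : Fintype.card (Fin t → (Fin N → H) × (Fin N → H) × (Fin N → H)) =
      Fintype.card ((Fin N → H) × (Fin N → H) × (Fin N → H)) ^ t := by
    rw [Fintype.card_fun, Fintype.card_fin]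
  have hκpos : 0 < Fintype.card κ := by
    rw [hκ]
    refine pow_pos (Finset.card_pos.2 ?_) 3
    by_contra hempty
    rw [Finset.not_nonempty_iff_eq_empty] at hempty
    have hT0 : T = 0 := by rw [hT, hempty, Finset.card_empty]
    rw [hT0, Nat.cast_zero, zero_mul] at hτ
    exact (pow_pos hHpos N).not_gt hτ
  have hK1 : 1 ≤ Fintype.card (Fin t → κ) := by rw [hKt]; exact Nat.one_le_pow _ _ hκpos
  have hLt1 : 1 ≤ L ^ t := Nat.one_le_pow _ _ (by omega)
  have hlt : (Fintype.card (Fin t → (Fin N → H) × (Fin N → H) × (Fin N → H)) : ℝ) <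
      Fintype.card (Fin t → κ) * ((L ^ t : ℕ) : ℝ) ^ (2 + ε / 2) := by
    rw [hGt, hKt]
    push_cast
    rw [← Real.rpow_natCast_mul (Nat.cast_nonneg L), mul_comm (t : ℝ),
      Real.rpow_mul_natCast (Nat.cast_nonneg L), ← mul_pow]
    exact pow_lt_pow_left₀ hkey (Nat.cast_nonneg _) (by omega)
  have hn : 2 ≤ (L ^ t) ^ Fintype.card (Fin t → κ) :=
    calc 2 ≤ L := hL2
      _ ≤ L ^ t := Nat.le_self_pow (by omega) L
      _ ≤ (L ^ t) ^ Fintype.card (Fin t → κ) := Nat.le_self_pow (by omega) _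
  have hr : ((Fintype.card (Sym (Fin t → (Fin N → H) × (Fin N → H) × (Fin N → H))
      (Fintype.card (Fin t → κ))) : ℕ) : ℝ) ≤
        (((L ^ t) ^ Fintype.card (Fin t → κ) : ℕ) : ℝ) ^ (2 + ε) := by
    rw [Sym.card_sym_eq_choose]
    exact choose_le_rpow_pow hK1 hLt1 (by positivity) hlt ht6
  exact commutativeRealization_body_of_uniform hSt hAt hBt hCt hn hr

end Summit.MatrixMultiplication.MatrixMultiplication.Theorems

end
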